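import Literature.Computability.Cryptography.PeriodFindingSums
import HarnessLib

/-!
# Autocorrelation mass of tables with digit-block structure

Topic `Computability/Cryptography`; companion of `PeriodFindingSums.lean` (`corrMass`, `corrMass_eq_sum_pairs`,
`corrMass_periodic`). Theorem-only file, no named facts.

Hallgren's shift experiment (`ShiftSampling*.lean`) Fourier-samples ONE cyclic register `[0, Q)`, `Q = 2^L`, through a
table `F`. When the table reads its argument as a word of digit BLOCKS — `v = p₁ + Q₁ p₂` with a low block
`p₁ < Q₁` and a high block `p₂ < Q₂`, `Q = Q₁ Q₂` — the measured frequency `c < Q` splits accordingly,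
`c = f₂ + Q₂ f₁` with `f₂ < Q₂`, `f₁ < Q₁`, and the character factorises as
`e(c v / Q) = e(f₂ p₂ / Q₂) · e((f₂ + Q₂ f₁) p₁ / Q)`: the HIGH block sees the exact integer frequency `f₂` (the LOW
digits of `c`), the low block sees `f₁` plus the known fractional offset `f₂ / Q₂` (`chr_blocks`). Consequences proved
here, all exact:

* `sum_range_chr_mul` — the geometric sum `∑_{t < a} e(c Q₀ t / (a Q₀)) = a · [a ∣ c]`;
* `corrMass_dvd_periodic` — if `F` has period `Q₀` and `Q = a Q₀`, then `corrMass Q F c = [a ∣ c] · a² · corrMass Q₀ F (c / a)`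
  (no injectivity assumption, unlike `corrMass_periodic`): a table that ignores its top block puts all the Fourier mass
  on the multiples of `a`, i.e. forces the low frequency digits to vanish;
* `corrMass_blocks_eq_sum_pairs` — the pair-sum form of `corrMass (Q₁ Q₂) F (f₂ + Q₂ f₁)` over pairs of block words.

These are the first bricks of the read-out analysis of multi-register tables flattened into one cyclic index
(the class-group core of `Summits/QuantumAdvantage/…/LinnikCubicClassGroups`).

## References

* P. W. Shor, SIAM J. Comput. 26 (1997), §5 (eqs. (5.5)–(5.7)). [Shor1997]
* R. Jozsa, arXiv:quant-ph/0302134 (2003), §10. [Jozsa2003]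
-/

noncomputable section

namespace Literature.Computability.Cryptography

namespace PeriodFinding

open Complex Finset Real Kitaev1995

variable {Ω : Type*} [DecidableEq Ω]

/-! ### Characters on block words -/

/-- **The character on a two-block word factorises**: for `v = p₁ + Q₁ p₂` and `c = f₂ + Q₂ f₁`,
`e(c v /(Q₁Q₂)) = e(f₂ p₂ / Q₂) · e(c p₁ /(Q₁ Q₂))` — the high block sees the low frequency digits exactly, the low
block sees the whole `c` at the fine scale (integer part `f₁`, fractional offset `f₂/Q₂`). [folklore] -/
theorem chr_blocks (Q₁ Q₂ : ℕ) (hQ₁ : 0 < Q₁) (hQ₂ : 0 < Q₂) (f₁ f₂ p₁ p₂ : ℤ) :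
    chr (Q₁ * Q₂) (f₂ + Q₂ * f₁) (p₁ + Q₁ * p₂) =
      chr Q₂ f₂ p₂ * chr (Q₁ * Q₂) (f₂ + Q₂ * f₁) p₁ := by
  have hQ₁' : (Q₁ : ℂ) ≠ 0 := by exact_mod_cast hQ₁.ne'
  have hQ₂' : (Q₂ : ℂ) ≠ 0 := by exact_mod_cast hQ₂.ne'
  unfold chr
  rw [← Complex.exp_add]
  -- the cross term `f₁ p₂` is an integer and drops out of the exponential
  have key : 2 * π * I * (((f₂ + Q₂ * f₁ : ℤ) : ℂ) * ((p₁ + Q₁ * p₂ : ℤ) : ℂ) / ((Q₁ * Q₂ : ℕ) : ℂ)) =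
      2 * π * I * (((f₂ : ℤ) : ℂ) * p₂ / (Q₂ : ℕ)) +
        2 * π * I * (((f₂ + Q₂ * f₁ : ℤ) : ℂ) * p₁ / ((Q₁ * Q₂ : ℕ) : ℂ)) + ((f₁ * p₂ : ℤ) : ℂ) * (2 * π * I) := by
    push_cast
    field_simp
    ring
  rw [key, Complex.exp_add, Complex.exp_int_mul_two_pi_mul_I, mul_one, Complex.exp_add]

/-- **Geometric sum over the top block**: `∑_{t < a} e(c (Q₀ t)/(a Q₀)) = a · [a ∣ c]`. [folklore] -/
theorem sum_range_chr_mul (a Q₀ : ℕ) (ha : 0 < a) (hQ₀ : 0 < Q₀) (c : ℤ) :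
    ∑ t ∈ range a, chr (a * Q₀) c ((Q₀ : ℤ) * t) = if (a : ℤ) ∣ c then (a : ℂ) else 0 := by
  have h : ∀ t ∈ range a, chr (a * Q₀) c ((Q₀ : ℤ) * t) = chr a t c := by
    intro t _
    unfold chr
    congr 1
    have hQ₀' : (Q₀ : ℂ) ≠ 0 := by exact_mod_cast hQ₀.ne'
    push_cast
    field_simp
  rw [sum_congr rfl h]
  exact sum_chr a ha c

/-- Reindexing `[0, Q₁ Q₂)` by block words `v = p₁ + Q₁ p₂`. [folklore] -/
theorem sum_range_mul_blocks {M : Type*} [AddCommMonoid M] (Q₁ Q₂ : ℕ) (G : ℕ → M) :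
    ∑ v ∈ range (Q₁ * Q₂), G v = ∑ p₂ ∈ range Q₂, ∑ p₁ ∈ range Q₁, G (p₁ + Q₁ * p₂) := by
  induction Q₂ with
  | zero => simp
  | succ n ih =>
    rw [Nat.mul_succ, sum_range_add, ih, sum_range_succ]
    congr 1
    exact sum_congr rfl fun p₁ _ => by rw [add_comm]

/-! ### A table that ignores its top block -/

/-- **Autocorrelation mass of a periodic table, without injectivity**: if `F v` depends only on `v mod Q₀` and
`Q = a · Q₀`, then `corrMass Q F c = a² · corrMass Q₀ F (c / a)` when `a ∣ c` and `0` otherwise. (Pairs `(v, v')`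
are `(r + Q₀ t, r' + Q₀ t')`; the `t`-sums are geometric.) For the shift experiment: a block of the register that the
table does not read forces the corresponding (low) digits of the measured frequency to vanish exactly.
[cite: Shor1997, §5 (eqs. (5.5)–(5.7))] -/
theorem corrMass_dvd_periodic (a Q₀ : ℕ) (ha : 0 < a) (hQ₀ : 0 < Q₀) (F : ℕ → Ω)
    (hF : ∀ v, F v = F (v % Q₀)) (c : ℤ) :
    corrMass (a * Q₀) F c = if (a : ℤ) ∣ c then (a : ℝ) ^ 2 * corrMass Q₀ F (c / a) else 0 := by
  apply Complex.ofReal_injective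
  rw [corrMass_eq_sum_pairs]
  -- reindex `[0, a Q₀)` as `[0, Q₀) × [0, a)` through `v = r + Q₀ t`
  have hsplit : ∀ G : ℕ → ℂ, ∑ v ∈ range (a * Q₀), G v = ∑ r ∈ range Q₀, ∑ t ∈ range a, G (r + Q₀ * t) := by
    intro G
    rw [show a * Q₀ = Q₀ * a by ring, sum_range_mul_blocks Q₀ a G, sum_comm]
  rw [hsplit]
  simp_rw [hsplit]
  -- evaluate the inner pair of `t`-sums
  have hper : ∀ r t : ℕ, F (r + Q₀ * t) = F r := fun r t => by
    rw [hF (r + Q₀ * t), hF r, Nat.add_mul_mod_self_left]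
  have hchr : ∀ r r' t t' : ℕ, chr (a * Q₀) c (((r + Q₀ * t : ℕ) : ℤ) - ((r' + Q₀ * t' : ℕ) : ℤ)) =
      chr (a * Q₀) c ((r : ℤ) - r') * (chr (a * Q₀) c ((Q₀ : ℤ) * t) * (starRingEnd ℂ) (chr (a * Q₀) c ((Q₀ : ℤ) * t'))) := by
    intro r r' t t'
    rw [conj_chr, ← chr_add, ← chr_add]
    congr 1
    push_cast
    ring
  have inner : ∀ r ∈ range Q₀, ∀ r' ∈ range Q₀,
      (∑ t ∈ range a, ∑ t' ∈ range a,
        if F (r + Q₀ * t) = F (r' + Q₀ * t') then chr (a * Q₀) c (((r + Q₀ * t : ℕ) : ℤ) - ((r' + Q₀ * t' : ℕ) : ℤ)) else 0) =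
      if F r = F r' then chr (a * Q₀) c ((r : ℤ) - r') * ‖∑ t ∈ range a, chr (a * Q₀) c ((Q₀ : ℤ) * t)‖ ^ 2 else 0 := by
    intro r _ r' _
    simp_rw [hper]
    by_cases h : F r = F r'
    · simp_rw [if_pos h, hchr, ← mul_sum]
      congr 1
      rw [cast_norm_sq_sum]
      simp_rw [mul_sum]
    · simp_rw [if_neg h]
      simp
  have hswap : (∑ r ∈ range Q₀, ∑ t ∈ range a, ∑ r' ∈ range Q₀, ∑ t' ∈ range a,
      if F (r + Q₀ * t) = F (r' + Q₀ * t') then chr (a * Q₀) c (((r + Q₀ * t : ℕ) : ℤ) - ((r' + Q₀ * t' : ℕ) : ℤ)) else 0) =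
      ∑ r ∈ range Q₀, ∑ r' ∈ range Q₀, ∑ t ∈ range a, ∑ t' ∈ range a,
      if F (r + Q₀ * t) = F (r' + Q₀ * t') then chr (a * Q₀) c (((r + Q₀ * t : ℕ) : ℤ) - ((r' + Q₀ * t' : ℕ) : ℤ)) else 0 :=
    sum_congr rfl fun r _ => sum_comm
  rw [hswap, sum_congr rfl fun r hr => sum_congr rfl fun r' hr' => inner r hr r' hr']
  rw [sum_range_chr_mul a Q₀ ha hQ₀ c]
  split_ifs with hdvd
  · -- `a ∣ c`: the remaining pair sum is `corrMass Q₀ F (c / a)`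
    obtain ⟨c', rfl⟩ := hdvd
    have hc' : (a : ℤ) * c' / a = c' := by
      rw [Int.mul_ediv_cancel_left _ (by exact_mod_cast ha.ne')]
    rw [hc', Complex.ofReal_mul, corrMass_eq_sum_pairs, mul_sum]
    refine sum_congr rfl fun r _ => ?_
    rw [mul_sum]
    refine sum_congr rfl fun r' _ => ?_
    split_ifs
    · rw [Complex.norm_natCast]
      have : chr (a * Q₀) (a * c') ((r : ℤ) - r') = chr Q₀ c' ((r : ℤ) - r') := by
        unfold chr
        congr 1
        have ha' : (a : ℂ) ≠ 0 := by exact_mod_cast ha.ne'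
        push_cast
        field_simp
      rw [this]
      push_cast
      ring
    · simp
  · simp

/-! ### Two blocks read by the table -/

/-- **Pair-sum form on block words**: for `Q = Q₁ Q₂` and the frequency `c = f₂ + Q₂ f₁`,
`corrMass Q F c = ∑_{(p₁,p₂),(p₁',p₂')} [F(p₁ + Q₁p₂) = F(p₁' + Q₁p₂')] · e(f₂ (p₂ − p₂')/Q₂) · e(c (p₁ − p₁')/Q)`
(sums over `p₁, p₁' < Q₁`, `p₂, p₂' < Q₂`). [folklore] -/
theorem corrMass_blocks_eq_sum_pairs (Q₁ Q₂ : ℕ) (hQ₁ : 0 < Q₁) (hQ₂ : 0 < Q₂) (F : ℕ → Ω) (f₁ f₂ : ℤ) :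
    ((corrMass (Q₁ * Q₂) F (f₂ + Q₂ * f₁) : ℝ) : ℂ) =
      ∑ p₂ ∈ range Q₂, ∑ p₁ ∈ range Q₁, ∑ p₂' ∈ range Q₂, ∑ p₁' ∈ range Q₁,
        if F (p₁ + Q₁ * p₂) = F (p₁' + Q₁ * p₂') then
          chr Q₂ f₂ ((p₂ : ℤ) - p₂') * chr (Q₁ * Q₂) (f₂ + Q₂ * f₁) ((p₁ : ℤ) - p₁') else 0 := by
  rw [corrMass_eq_sum_pairs]
  have hsplit : ∀ G : ℕ → ℂ, ∑ v ∈ range (Q₁ * Q₂), G v = ∑ p₂ ∈ range Q₂, ∑ p₁ ∈ range Q₁, G (p₁ + Q₁ * p₂) :=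
    fun G => sum_range_mul_blocks Q₁ Q₂ G
  rw [hsplit]
  simp_rw [hsplit]
  refine sum_congr rfl fun p₂ _ => sum_congr rfl fun p₁ _ => sum_congr rfl fun p₂' _ => sum_congr rfl fun p₁' _ => ?_
  split_ifs
  · have e : ((p₁ + Q₁ * p₂ : ℕ) : ℤ) - ((p₁' + Q₁ * p₂' : ℕ) : ℤ) = ((p₁ : ℤ) - p₁') + Q₁ * ((p₂ : ℤ) - p₂') := by
      push_cast; ring
    rw [e, chr_blocks Q₁ Q₂ hQ₁ hQ₂]
  · rfl

/-! ### Tables that differ on few arguments -/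

/-- The fibre sum of characters of the level set of `ω` (the `ω`-component of the transform of the table state).
[folklore] -/
theorem fibreSum_sub_fibreSum (Q : ℕ) (F F₀ : ℕ → Ω) (c : ℤ) (ω : Ω) :
    (∑ v ∈ (range Q).filter (fun v => F v = ω), chr Q c v) - ∑ v ∈ (range Q).filter (fun v => F₀ v = ω), chr Q c v =
      ∑ v ∈ (range Q).filter (fun v => F v ≠ F₀ v),
        ((if F v = ω then (1 : ℂ) else 0) - (if F₀ v = ω then 1 else 0)) * chr Q c v := by
  rw [sum_filter, sum_filter, ← sum_sub_distrib, sum_filter]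
  refine sum_congr rfl fun v _ => ?_
  by_cases h : F v = F₀ v
  · rw [if_neg (not_not.2 h), h]; split_ifs <;> simp
  · rw [if_pos h]; split_ifs <;> simp

/-- **Parseval for the difference of two tables**: summed over all characters `c < Q` and all values `ω`, the squared
norms of the differences of the fibre sums equal `2 Q · #{v < Q : F v ≠ F₀ v}` (at most; exactly when the value
sets are accounted with multiplicity — we prove the inequality, which is all that is used). [folklore] -/
theorem sum_norm_sq_fibreSum_sub_le (Q : ℕ) (hQ : 0 < Q) (F F₀ : ℕ → Ω) (S : Finset Ω)
    (hS : ∀ v < Q, F v ∈ S ∧ F₀ v ∈ S) :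
    ∑ c ∈ range Q, ∑ ω ∈ S,
      ‖(∑ v ∈ (range Q).filter (fun v => F v = ω), chr Q c v) - ∑ v ∈ (range Q).filter (fun v => F₀ v = ω), chr Q c v‖ ^ 2
      ≤ 2 * Q * ((range Q).filter (fun v => F v ≠ F₀ v)).card := by
  classical
  set D := (range Q).filter (fun v => F v ≠ F₀ v) with hD
  -- the coefficient of `v ∈ D` in the `ω`-component
  set a : Ω → ℕ → ℂ := fun ω v => (if F v = ω then (1 : ℂ) else 0) - (if F₀ v = ω then 1 else 0) with ha
  have hre : ∀ c ω, (∑ v ∈ (range Q).filter (fun v => F v = ω), chr Q c v) -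
      ∑ v ∈ (range Q).filter (fun v => F₀ v = ω), chr Q c v = ∑ v ∈ D, a ω v * chr Q c v :=
    fun c ω => fibreSum_sub_fibreSum Q F F₀ c ω
  simp_rw [hre]
  -- Parseval in `c`: `∑_c |∑_{v∈D} a v e(cv/Q)|² = Q ∑_{v∈D} |a v|²`
  have hpars : ∀ ω ∈ S, (∑ c ∈ range Q, ((‖∑ v ∈ D, a ω v * chr Q c v‖ : ℝ) : ℂ) ^ 2) =
      (Q : ℂ) * ∑ v ∈ D, a ω v * (starRingEnd ℂ) (a ω v) := by
    intro ω _
    simp_rw [cast_norm_sq_sum]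
    rw [sum_comm]
    have : ∀ v ∈ D, (∑ c ∈ range Q, ∑ v' ∈ D, a ω v * chr Q c v * (starRingEnd ℂ) (a ω v' * chr Q c v')) =
        (Q : ℂ) * (a ω v * (starRingEnd ℂ) (a ω v)) := by
      intro v hv
      rw [sum_comm]
      have hvQ : v < Q := mem_range.1 (mem_filter.1 hv).1
      have inner : ∀ v' ∈ D, (∑ c ∈ range Q, a ω v * chr Q c v * (starRingEnd ℂ) (a ω v' * chr Q c v')) =
          if v' = v then (Q : ℂ) * (a ω v * (starRingEnd ℂ) (a ω v)) else 0 := by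
        intro v' hv'
        have hv'Q : v' < Q := mem_range.1 (mem_filter.1 hv').1
        have e : ∀ c : ℕ, a ω v * chr Q c v * (starRingEnd ℂ) (a ω v' * chr Q c v') =
            a ω v * (starRingEnd ℂ) (a ω v') * chr Q c ((v : ℤ) - v') := by
          intro c
          rw [map_mul, conj_chr, show ((v : ℤ) - v') = v + -(v' : ℤ) by ring, chr_add]
          ring
        simp_rw [e]
        rw [← mul_sum, sum_chr Q hQ]
        by_cases hvv : v' = v
        · subst hvv
          simp [mul_comm]
        · rw [if_neg (fun h => hvv ((dvd_sub_iff_eq hvQ hv'Q).1 h)), if_neg hvv, mul_zero]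
      rw [sum_congr rfl inner, sum_ite_eq' D v, if_pos hv]
    rw [sum_congr rfl this, mul_sum]
  -- cast to `ℂ`, swap the sums, apply Parseval
  have hcast : ((∑ c ∈ range Q, ∑ ω ∈ S, ‖∑ v ∈ D, a ω v * chr Q c v‖ ^ 2 : ℝ) : ℂ) =
      (Q : ℂ) * ∑ ω ∈ S, ∑ v ∈ D, a ω v * (starRingEnd ℂ) (a ω v) := by
    push_cast
    rw [sum_comm, mul_sum]
    refine sum_congr rfl fun ω hω => ?_
    rw [← hpars ω hω]
  -- evaluate `∑_ω |a ω v|² ≤ 2` for `v ∈ D`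
  have hval : ∀ v ∈ D, (∑ ω ∈ S, a ω v * (starRingEnd ℂ) (a ω v)) = 2 := by
    intro v hv
    obtain ⟨hvQ, hne⟩ := mem_filter.1 hv
    obtain ⟨h1, h2⟩ := hS v (mem_range.1 hvQ)
    have hterm : ∀ ω ∈ S, a ω v * (starRingEnd ℂ) (a ω v) =
        (if F v = ω then (1 : ℂ) else 0) + (if F₀ v = ω then 1 else 0) := by
      intro ω _
      simp only [ha]
      by_cases hF : F v = ω <;> by_cases hF₀ : F₀ v = ω
      · exact absurd (hF.trans hF₀.symm) hne
      · simp [hF, hF₀]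
      · simp [hF, hF₀]
      · simp [hF, hF₀]
    rw [sum_congr rfl hterm, sum_add_distrib, sum_ite_eq, sum_ite_eq, if_pos h1, if_pos h2]
    norm_num
  have hfin : ((∑ c ∈ range Q, ∑ ω ∈ S, ‖∑ v ∈ D, a ω v * chr Q c v‖ ^ 2 : ℝ) : ℂ) = ((2 * Q * D.card : ℝ) : ℂ) := by
    rw [hcast, sum_comm, sum_congr rfl hval, sum_const, nsmul_eq_mul]
    push_cast; ring
  exact le_of_eq (by exact_mod_cast hfin)

/-- **The autocorrelation masses of two tables that differ on few arguments are close in total variation**: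
`∑_{c<Q} |corrMass Q F c − corrMass Q F₀ c| ≤ 2 Q² √(2 #{v<Q : F v ≠ F₀ v} / Q)`, i.e. the two unit weights
(`corrMass / Q²`) are within `2 √(2 δ)` in `ℓ¹` when the tables differ on a fraction `δ` of the register
(Cauchy–Schwarz on the fibre-sum vectors, `sum_norm_sq_fibreSum_sub_le`, and `sum_corrMass`). [folklore] -/
theorem sum_abs_corrMass_sub_le (Q : ℕ) (hQ : 0 < Q) (F F₀ : ℕ → Ω) :
    ∑ c ∈ range Q, |corrMass Q F c - corrMass Q F₀ c| ≤
      2 * (Q : ℝ) ^ 2 * Real.sqrt (2 * ((range Q).filter (fun v => F v ≠ F₀ v)).card / Q) := by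
  classical
  -- common value set
  set S : Finset Ω := (range Q).image F ∪ (range Q).image F₀ with hS
  have hSv : ∀ v < Q, F v ∈ S ∧ F₀ v ∈ S := fun v hv =>
    ⟨mem_union_left _ (mem_image_of_mem F (mem_range.2 hv)), mem_union_right _ (mem_image_of_mem F₀ (mem_range.2 hv))⟩
  -- fibre-sum vectors
  set A : ℤ → Ω → ℂ := fun c ω => ∑ v ∈ (range Q).filter (fun v => F v = ω), chr Q c v with hA
  set B : ℤ → Ω → ℂ := fun c ω => ∑ v ∈ (range Q).filter (fun v => F₀ v = ω), chr Q c v with hB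
  -- `corrMass` over the common value set (extra values contribute empty fibres)
  have hcm : ∀ (G : ℕ → Ω) (c : ℤ), (∀ v < Q, G v ∈ S) →
      corrMass Q G c = ∑ ω ∈ S, ‖∑ v ∈ (range Q).filter (fun v => G v = ω), chr Q c v‖ ^ 2 := by
    intro G c hG
    unfold corrMass
    refine sum_subset (fun ω hω => ?_) (fun ω _ hω => ?_)
    · obtain ⟨v, hv, rfl⟩ := mem_image.1 hω
      exact hG v (mem_range.1 hv)
    · have : (range Q).filter (fun v => G v = ω) = ∅ := by
        refine filter_eq_empty_iff.2 fun v hv h => hω (mem_image.2 ⟨v, hv, h⟩)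
      rw [this]; simp
  have hA' : ∀ c : ℤ, corrMass Q F c = ∑ ω ∈ S, ‖A c ω‖ ^ 2 := fun c => hcm F c fun v hv => (hSv v hv).1
  have hB' : ∀ c : ℤ, corrMass Q F₀ c = ∑ ω ∈ S, ‖B c ω‖ ^ 2 := fun c => hcm F₀ c fun v hv => (hSv v hv).2
  -- pointwise: `|‖A‖² − ‖B‖²| ≤ ‖A − B‖ (‖A‖ + ‖B‖)` summed over `ω`, then Cauchy–Schwarz over `(c, ω)`
  have hpt : ∀ c : ℤ, |corrMass Q F c - corrMass Q F₀ c| ≤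
      ∑ ω ∈ S, ‖A c ω - B c ω‖ * (‖A c ω‖ + ‖B c ω‖) := by
    intro c
    rw [hA' c, hB' c, ← sum_sub_distrib]
    refine (abs_sum_le_sum_abs _ _).trans (sum_le_sum fun ω _ => ?_)
    have h1 : |‖A c ω‖ ^ 2 - ‖B c ω‖ ^ 2| = (‖A c ω‖ + ‖B c ω‖) * |‖A c ω‖ - ‖B c ω‖| := by
      rw [sq_sub_sq, abs_mul, abs_of_nonneg (add_nonneg (norm_nonneg _) (norm_nonneg _))]
    rw [h1, mul_comm]
    exact mul_le_mul_of_nonneg_right (abs_norm_sub_norm_le _ _) (add_nonneg (norm_nonneg _) (norm_nonneg _))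
  -- the two Cauchy–Schwarz factors
  have hX : ∑ c ∈ range Q, ∑ ω ∈ S, ‖A c ω - B c ω‖ ^ 2 ≤ 2 * Q * ((range Q).filter (fun v => F v ≠ F₀ v)).card := by
    have := sum_norm_sq_fibreSum_sub_le Q hQ F F₀ S hSv
    simpa only [hA, hB] using this
  have hY : ∑ c ∈ range Q, ∑ ω ∈ S, (‖A c ω‖ + ‖B c ω‖) ^ 2 ≤ 4 * (Q : ℝ) ^ 2 := by
    have h2 : ∀ c ω, (‖A c ω‖ + ‖B c ω‖) ^ 2 ≤ 2 * (‖A c ω‖ ^ 2 + ‖B c ω‖ ^ 2) := fun c ω => by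
      nlinarith [sq_nonneg (‖A c ω‖ - ‖B c ω‖)]
    calc ∑ c ∈ range Q, ∑ ω ∈ S, (‖A c ω‖ + ‖B c ω‖) ^ 2
        ≤ ∑ c ∈ range Q, ∑ ω ∈ S, 2 * (‖A c ω‖ ^ 2 + ‖B c ω‖ ^ 2) := sum_le_sum fun c _ => sum_le_sum fun ω _ => h2 c ω
      _ = 2 * (∑ c ∈ range Q, corrMass Q F c + ∑ c ∈ range Q, corrMass Q F₀ c) := by
          rw [← sum_add_distrib, mul_sum]
          refine sum_congr rfl fun c _ => ?_
          rw [hA' c, hB' c, ← sum_add_distrib, mul_sum]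
      _ = 4 * (Q : ℝ) ^ 2 := by
          have h1 : ∑ c ∈ range Q, corrMass Q F (c : ℤ) = (Q : ℝ) ^ 2 := by exact_mod_cast sum_corrMass Q hQ F
          have h2 : ∑ c ∈ range Q, corrMass Q F₀ (c : ℤ) = (Q : ℝ) ^ 2 := by exact_mod_cast sum_corrMass Q hQ F₀
          rw [h1, h2]; ring
  -- Cauchy–Schwarz over the product index set
  have hCS : (∑ c ∈ range Q, ∑ ω ∈ S, ‖A c ω - B c ω‖ * (‖A c ω‖ + ‖B c ω‖)) ^ 2 ≤
      (∑ c ∈ range Q, ∑ ω ∈ S, ‖A c ω - B c ω‖ ^ 2) * (∑ c ∈ range Q, ∑ ω ∈ S, (‖A c ω‖ + ‖B c ω‖) ^ 2) := by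
    simp_rw [← sum_product']
    exact sum_mul_sq_le_sq_mul_sq _ _ _
  have hLHS : ∑ c ∈ range Q, |corrMass Q F c - corrMass Q F₀ c| ≤
      ∑ c ∈ range Q, ∑ ω ∈ S, ‖A c ω - B c ω‖ * (‖A c ω‖ + ‖B c ω‖) := sum_le_sum fun c _ => hpt c
  have hprod : (∑ c ∈ range Q, ∑ ω ∈ S, ‖A c ω - B c ω‖ * (‖A c ω‖ + ‖B c ω‖)) ^ 2 ≤
      (2 * Q * ((range Q).filter (fun v => F v ≠ F₀ v)).card) * (4 * (Q : ℝ) ^ 2) :=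
    hCS.trans (mul_le_mul hX hY (by positivity) (by positivity))
  have hnn : 0 ≤ ∑ c ∈ range Q, ∑ ω ∈ S, ‖A c ω - B c ω‖ * (‖A c ω‖ + ‖B c ω‖) := by positivity
  -- take square roots
  have hQr : (0 : ℝ) < Q := by exact_mod_cast hQ
  have htarget : Real.sqrt ((2 * Q * ((range Q).filter (fun v => F v ≠ F₀ v)).card) * (4 * (Q : ℝ) ^ 2)) =
      2 * (Q : ℝ) ^ 2 * Real.sqrt (2 * ((range Q).filter (fun v => F v ≠ F₀ v)).card / Q) := by
    have e : (2 * Q * (((range Q).filter (fun v => F v ≠ F₀ v)).card : ℝ)) * (4 * (Q : ℝ) ^ 2) =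
        (2 * (Q : ℝ) ^ 2) ^ 2 * (2 * ((range Q).filter (fun v => F v ≠ F₀ v)).card / Q) := by
      field_simp; ring
    rw [e, Real.sqrt_mul (by positivity), Real.sqrt_sq (by positivity)]
  calc ∑ c ∈ range Q, |corrMass Q F c - corrMass Q F₀ c|
      ≤ ∑ c ∈ range Q, ∑ ω ∈ S, ‖A c ω - B c ω‖ * (‖A c ω‖ + ‖B c ω‖) := hLHS
    _ = Real.sqrt ((∑ c ∈ range Q, ∑ ω ∈ S, ‖A c ω - B c ω‖ * (‖A c ω‖ + ‖B c ω‖)) ^ 2) := (Real.sqrt_sq hnn).symm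
    _ ≤ Real.sqrt ((2 * Q * ((range Q).filter (fun v => F v ≠ F₀ v)).card) * (4 * (Q : ℝ) ^ 2)) := Real.sqrt_le_sqrt hprod
    _ = _ := htarget

end PeriodFinding

end Literature.Computability.Cryptography

end
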